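import Mathlib
import Literature.Probability.Percolation.SharpnessDCTProofs
import HarnessLib

/-!
# Route `PercHyperscalingGluing`, support item `FewClustersGlue` (stmt-CriticalPhenomena-4646): tools

Helper file (`--supports stmt-CriticalPhenomena-4646`) for the proof of
`Summit.CriticalPhenomena.PercolationContinuityZ3.Theses.PercHyperscalingGluing.FewClustersGlue`
(`ArmsInFewClusters → BoxGluing`), assembled in `Theorems/PercHyperscalingGluingFewClustersGlue.lean`.
Notation of the docstrings: `Λ_m = box d m`, `A_x = DCT16.armEvent x n` (translated one-arm event),
`C_{xy} = {x ↔ y in Λ_{Kn}} = openConnIn ↑(box d (K * n)) x y`, `Few` = "every family of `n`-armed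
sites of `Λ_n`, pairwise not joined inside `Λ_{Kn}`, has at most `N0` members" (written out in full
in every statement — this file introduces no definition), `S(ω) = #{x ∈ Λ_n : ω ∈ A_x}`.

* `card_sq_le_mul_card_filter` — **combinatorics**: for an equivalence relation `r` on a finite set
  `s` whose `r`-independent subfamilies have `≤ N0` members, `|s|² ≤ N0 · #{(x, y) ∈ s² : r x y}`
  (a maximum independent family `M` meets every class; the classes `N(m)`, `m ∈ M`, are pairwise
  disjoint with `N(m)² ⊆ {related pairs}`; Cauchy–Schwarz `(Σ_m |N(m)|)² ≤ |M| Σ_m |N(m)|²`).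
* `sq_sum_measureReal_inter_le` — **second moment**: for a probability measure, if on `F` the count
  `S` of occurring events `A_i` has `S² ≤ N0 Σ_{i,j} 1_{C_{ij}}`, then
  `(Σ_i P(A_i ∩ F))² ≤ N0 Σ_{i,j} P(C_{ij})` (`(E[1_F S])² ≤ E[1_F S²]`, variance `≥ 0`).
* `pointwise` — on `Few`, `S² ≤ N0 · Σ_{x,y ∈ Λ_n} 1_{C_{xy}}` ("joined inside `Λ_{Kn}`" is an
  equivalence relation on `Λ_n ⊆ Λ_{Kn}`, `K ≥ 1`).
* `measurableSet_armEvent`, `measurableSet_few` — measurability of `A_x` and of `Few`.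

These are the moments `k = 1, 2` of the number of armed sites of Aizenman's proliferation count
(Aizenman 1997, App. A) in the cluster-number form of the route; elementary, no percolation input
beyond the definitions. Pure proof file, no definitions.
-/

noncomputable section

namespace Summit.CriticalPhenomena.PercolationContinuityZ3.Theorems

open MeasureTheory ProbabilityTheory
open Literature.Probability.Percolation Literature.Probability.LatticeModels

/-! ## Combinatorics: few independent armed sites force many joined pairs -/

/-- **Cauchy–Schwarz over the classes.** If `r` is an equivalence relation on the finite set `s`
all of whose `r`-independent subfamilies have at most `N0` members, then
`|s|² ≤ N0 · #{(x, y) ∈ s × s : r x y}`. (A maximum independent family `M` meets every class;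
the classes of its members are pairwise disjoint squares inside the set of related pairs.)
[folklore] -/
theorem FewClustersGlue.card_sq_le_mul_card_filter {α : Type*} [DecidableEq α] (s : Finset α)
    (r : α → α → Prop) [DecidableRel r] (hrefl : ∀ x ∈ s, r x x)
    (hsymm : ∀ x ∈ s, ∀ y ∈ s, r x y → r y x)
    (htrans : ∀ x ∈ s, ∀ y ∈ s, ∀ z ∈ s, r x y → r y z → r x z) (N0 : ℕ)
    (hfew : ∀ M ⊆ s, (↑M : Set α).Pairwise (fun x y => ¬ r x y) → M.card ≤ N0) :
    s.card ^ 2 ≤ N0 * ((s ×ˢ s).filter (fun p => r p.1 p.2)).card := by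
  classical
  -- the independent subfamilies of `s`, and one of maximum cardinality
  set I : Finset (Finset α) :=
    s.powerset.filter (fun M => (↑M : Set α).Pairwise (fun x y => ¬ r x y)) with hI
  have hempty : (∅ : Finset α) ∈ I := by
    rw [hI, Finset.mem_filter, Finset.mem_powerset]
    exact ⟨Finset.empty_subset s, by simp⟩
  obtain ⟨M, hMI, hMmax⟩ := Finset.exists_max_image I Finset.card ⟨∅, hempty⟩
  rw [hI, Finset.mem_filter, Finset.mem_powerset] at hMI
  obtain ⟨hMs, hMind⟩ := hMI
  -- every element of `s` is related to some member of `M`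
  have hcover : ∀ x ∈ s, ∃ m ∈ M, r x m := by
    intro x hx
    by_contra hno
    push Not at hno
    have hxM : x ∉ M := fun h => hno x h (hrefl x hx)
    have hins : insert x M ∈ I := by
      rw [hI, Finset.mem_filter, Finset.mem_powerset]
      refine ⟨Finset.insert_subset hx hMs, ?_⟩
      rw [Finset.coe_insert, Set.pairwise_insert]
      exact ⟨hMind, fun b hb _ => ⟨hno b hb, fun h => hno b hb (hsymm b (hMs hb) x hx h)⟩⟩
    have hle := hMmax _ hins
    rw [Finset.card_insert_of_notMem hxM] at hle
    omega
  -- the classes of the members of `M`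
  set N : α → Finset α := fun m => s.filter (fun x => r x m) with hN
  have hsub : s ⊆ M.biUnion N := by
    intro x hx
    obtain ⟨m, hm, hxm⟩ := hcover x hx
    exact Finset.mem_biUnion.2 ⟨m, hm, Finset.mem_filter.2 ⟨hx, hxm⟩⟩
  have h1 : s.card ≤ ∑ m ∈ M, (N m).card :=
    (Finset.card_le_card hsub).trans Finset.card_biUnion_le
  have h2 : (∑ m ∈ M, (N m).card) ^ 2 ≤ M.card * ∑ m ∈ M, (N m).card ^ 2 :=
    sq_sum_le_card_mul_sum_sq
  have hdisj : (↑M : Set α).PairwiseDisjoint (fun m => N m ×ˢ N m) := by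
    intro m hm m' hm' hne
    rw [Function.onFun, Finset.disjoint_left]
    rintro ⟨x, y⟩ hp hp'
    rw [Finset.mem_product] at hp hp'
    obtain ⟨hxs, hxm⟩ := Finset.mem_filter.1 hp.1
    have hxm' : r x m' := (Finset.mem_filter.1 hp'.1).2
    exact hMind hm hm' hne
      (htrans m (hMs hm) x hxs m' (hMs hm') (hsymm x hxs m (hMs hm) hxm) hxm')
  have h3 : ∑ m ∈ M, (N m).card ^ 2 ≤ ((s ×ˢ s).filter (fun p => r p.1 p.2)).card := by
    have heq : ∑ m ∈ M, (N m).card ^ 2 = (M.biUnion fun m => N m ×ˢ N m).card := by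
      rw [Finset.card_biUnion hdisj]
      refine Finset.sum_congr rfl fun m _ => ?_
      rw [Finset.card_product, sq]
    rw [heq]
    refine Finset.card_le_card fun p hp => ?_
    obtain ⟨m, hm, hpm⟩ := Finset.mem_biUnion.1 hp
    rw [Finset.mem_product] at hpm
    obtain ⟨hx, hxm⟩ := Finset.mem_filter.1 hpm.1
    obtain ⟨hy, hym⟩ := Finset.mem_filter.1 hpm.2
    exact Finset.mem_filter.2 ⟨Finset.mem_product.2 ⟨hx, hy⟩,
      htrans p.1 hx m (hMs hm) p.2 hy hxm (hsymm p.2 hy m (hMs hm) hym)⟩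
  have hMcard : M.card ≤ N0 := hfew M hMs hMind
  calc s.card ^ 2 ≤ (∑ m ∈ M, (N m).card) ^ 2 := Nat.pow_le_pow_left h1 2
    _ ≤ M.card * ∑ m ∈ M, (N m).card ^ 2 := h2
    _ ≤ N0 * ((s ×ˢ s).filter (fun p => r p.1 p.2)).card := Nat.mul_le_mul hMcard h3

/-! ## Integration: a second-moment bound from a pointwise one -/

/-- **Second-moment step.** For a probability measure, events `A i`, `C i j` (`i, j ∈ I`) and `F`,
if on `F` the number `S` of occurring `A i` satisfies `S² ≤ N0 · Σ_{i,j} 1_{C i j}` pointwise, then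
`(Σ_i P(A_i ∩ F))² ≤ N0 Σ_{i,j} P(C_{ij})`: indeed `(E[1_F S])² ≤ E[1_F S²]` (variance `≥ 0`) and
the pointwise bound integrates. [folklore] -/
theorem FewClustersGlue.sq_sum_measureReal_inter_le {Ω ι : Type*} [MeasurableSpace Ω]
    (μ : Measure Ω) [IsProbabilityMeasure μ] (I : Finset ι) (A : ι → Set Ω) (C : ι → ι → Set Ω)
    (F : Set Ω) (hA : ∀ i ∈ I, MeasurableSet (A i))
    (hC : ∀ i ∈ I, ∀ j ∈ I, MeasurableSet (C i j)) (hF : MeasurableSet F) (N0 : ℕ)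
    (hpt : ∀ ω ∈ F, (∑ i ∈ I, (A i).indicator (1 : Ω → ℝ) ω) ^ 2 ≤
      N0 * ∑ i ∈ I, ∑ j ∈ I, (C i j).indicator (1 : Ω → ℝ) ω) :
    (∑ i ∈ I, μ.real (A i ∩ F)) ^ 2 ≤ N0 * ∑ i ∈ I, ∑ j ∈ I, μ.real (C i j) := by
  classical
  set X : Ω → ℝ := fun ω => ∑ i ∈ I, (A i ∩ F).indicator (1 : Ω → ℝ) ω with hX
  set Y : Ω → ℝ := fun ω => ∑ i ∈ I, ∑ j ∈ I, (C i j).indicator (1 : Ω → ℝ) ω with hY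
  have hXmeas : Measurable X :=
    Finset.measurable_sum I fun i hi => measurable_const.indicator ((hA i hi).inter hF)
  have hYmeas : Measurable Y :=
    Finset.measurable_sum I fun i hi =>
      Finset.measurable_sum I fun j hj => measurable_const.indicator (hC i hi j hj)
  have hind_le : ∀ (s : Set Ω) (ω : Ω), ‖s.indicator (1 : Ω → ℝ) ω‖ ≤ 1 := by
    intro s ω
    rw [Real.norm_eq_abs, Set.indicator_apply]
    split_ifs <;> simp
  have hind_nn : ∀ (s : Set Ω) (ω : Ω), 0 ≤ s.indicator (1 : Ω → ℝ) ω := by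
    intro s ω
    rw [Set.indicator_apply]
    split_ifs <;> simp
  have hXbound : ∀ ω, ‖X ω‖ ≤ I.card := by
    intro ω
    calc ‖X ω‖ ≤ ∑ i ∈ I, ‖(A i ∩ F).indicator (1 : Ω → ℝ) ω‖ := norm_sum_le _ _
      _ ≤ ∑ i ∈ I, (1 : ℝ) := Finset.sum_le_sum fun i _ => hind_le _ ω
      _ = I.card := by simp
  have hYbound : ∀ ω, ‖Y ω‖ ≤ I.card * I.card := by
    intro ω
    calc ‖Y ω‖ ≤ ∑ i ∈ I, ‖∑ j ∈ I, (C i j).indicator (1 : Ω → ℝ) ω‖ := norm_sum_le _ _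
      _ ≤ ∑ i ∈ I, ∑ j ∈ I, ‖(C i j).indicator (1 : Ω → ℝ) ω‖ :=
          Finset.sum_le_sum fun i _ => norm_sum_le _ _
      _ ≤ ∑ i ∈ I, ∑ j ∈ I, (1 : ℝ) :=
          Finset.sum_le_sum fun i _ => Finset.sum_le_sum fun j _ => hind_le _ ω
      _ = I.card * I.card := by simp
  have hX2 : MemLp X 2 μ :=
    MemLp.of_bound hXmeas.aestronglyMeasurable (I.card : ℝ) (ae_of_all _ hXbound)
  have hYint : Integrable Y μ :=
    Integrable.of_bound hYmeas.aestronglyMeasurable ((I.card : ℝ) * I.card) (ae_of_all _ hYbound)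
  -- the two expectations
  have hEX : ∫ ω, X ω ∂μ = ∑ i ∈ I, μ.real (A i ∩ F) := by
    simp only [hX]
    rw [integral_finsetSum I (f := fun i ω => (A i ∩ F).indicator (1 : Ω → ℝ) ω)
      (fun i hi => (integrable_const (1 : ℝ)).indicator ((hA i hi).inter hF))]
    exact Finset.sum_congr rfl fun i hi => integral_indicator_one ((hA i hi).inter hF)
  have hEY : ∫ ω, Y ω ∂μ = ∑ i ∈ I, ∑ j ∈ I, μ.real (C i j) := by
    simp only [hY]
    rw [integral_finsetSum I
      (f := fun i ω => ∑ j ∈ I, (C i j).indicator (1 : Ω → ℝ) ω)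
      (fun i hi => integrable_finsetSum I
        (f := fun j ω => (C i j).indicator (1 : Ω → ℝ) ω)
        (fun j hj => (integrable_const (1 : ℝ)).indicator (hC i hi j hj)))]
    refine Finset.sum_congr rfl fun i hi => ?_
    rw [integral_finsetSum I (f := fun j ω => (C i j).indicator (1 : Ω → ℝ) ω)
      (fun j hj => (integrable_const (1 : ℝ)).indicator (hC i hi j hj))]
    exact Finset.sum_congr rfl fun j hj => integral_indicator_one (hC i hi j hj)
  -- Jensen / variance: `(E X)² ≤ E X²`
  have hJ : (∫ ω, X ω ∂μ) ^ 2 ≤ ∫ ω, X ω ^ 2 ∂μ := by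
    have h := variance_eq_sub hX2
    have h0 := variance_nonneg X μ
    have h2 : μ[X ^ 2] = ∫ ω, X ω ^ 2 ∂μ := rfl
    linarith
  -- pointwise `X² ≤ N0 · Y`
  have hpt' : ∀ ω, X ω ^ 2 ≤ N0 * Y ω := by
    intro ω
    by_cases hω : ω ∈ F
    · have hXω : X ω = ∑ i ∈ I, (A i).indicator (1 : Ω → ℝ) ω := by
        rw [hX]
        refine Finset.sum_congr rfl fun i _ => ?_
        simp only [Set.indicator_apply, Set.mem_inter_iff, hω, and_true]
      rw [hXω]
      exact hpt ω hω
    · have hXω : X ω = 0 := by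
        rw [hX]
        refine Finset.sum_eq_zero fun i _ => ?_
        simp [hω]
      rw [hXω]
      have hYnn : 0 ≤ Y ω :=
        Finset.sum_nonneg fun i _ => Finset.sum_nonneg fun j _ => hind_nn _ ω
      have : (0 : ℝ) ≤ N0 * Y ω := mul_nonneg (Nat.cast_nonneg N0) hYnn
      simpa using this
  have hmono : ∫ ω, X ω ^ 2 ∂μ ≤ ∫ ω, (N0 : ℝ) * Y ω ∂μ :=
    integral_mono hX2.integrable_sq (hYint.const_mul _) hpt'
  rw [integral_const_mul, hEY] at hmono
  rw [← hEX]
  exact hJ.trans hmono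

/-! ## The pointwise bound on `Few` -/

/-- **`S² ≤ N0 · T` on `Few`.** For a configuration in which every family of `n`-armed sites of
`Λ_n`, pairwise not joined inside `Λ_{Kn}` (`K ≥ 1`), has at most `N0` members, the number `S` of
armed sites of `Λ_n` satisfies `S² ≤ N0 · #{(x, y) ∈ Λ_n² : x ↔ y in Λ_{Kn}}` ("joined inside
`Λ_{Kn}`" is an equivalence relation on `Λ_n ⊆ Λ_{Kn}`; `card_sq_le_mul_card_filter`).
[folklore] -/
theorem FewClustersGlue.pointwise {d : ℕ} (N0 K n : ℕ) (hK : 1 ≤ K) (ω : BondConfig (Site d))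
    (hω : ∀ F : Finset (Site d), F ⊆ box d n → (∀ y ∈ F, ω ∈ DCT16.armEvent y n) →
      (↑F : Set (Site d)).Pairwise (fun y z => ω ∉ openConnIn ↑(box d (K * n)) y z) →
      F.card ≤ N0) :
    (∑ x ∈ box d n, (DCT16.armEvent x n).indicator (1 : BondConfig (Site d) → ℝ) ω) ^ 2 ≤
      N0 * ∑ x ∈ box d n, ∑ y ∈ box d n,
        (openConnIn (↑(box d (K * n)) : Set (Site d)) x y).indicator
          (1 : BondConfig (Site d) → ℝ) ω := by
  classical
  set s : Finset (Site d) := (box d n).filter (fun x => ω ∈ DCT16.armEvent x n) with hs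
  have hsbox : s ⊆ box d n := Finset.filter_subset _ _
  have hbox : box d n ⊆ box d (K * n) :=
    box_mono d (by simpa using Nat.mul_le_mul_right n hK)
  -- the left-hand side is `|s|²`
  have hS : ∑ x ∈ box d n, (DCT16.armEvent x n).indicator (1 : BondConfig (Site d) → ℝ) ω =
      (s.card : ℝ) := by
    rw [hs]
    simp only [Set.indicator_apply, Pi.one_apply]
    rw [Finset.sum_boole]
  -- the right-hand side dominates the number of joined pairs of armed sites
  set r : Site d → Site d → Prop := fun x y => ω ∈ openConnIn (↑(box d (K * n)) : Set (Site d)) x y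
    with hr
  have hT : (((s ×ˢ s).filter (fun p => r p.1 p.2)).card : ℝ) ≤
      ∑ x ∈ box d n, ∑ y ∈ box d n,
        (openConnIn (↑(box d (K * n)) : Set (Site d)) x y).indicator
          (1 : BondConfig (Site d) → ℝ) ω := by
    rw [← Finset.sum_product (s := box d n) (t := box d n)
      (f := fun p => (openConnIn (↑(box d (K * n)) : Set (Site d)) p.1 p.2).indicator
        (1 : BondConfig (Site d) → ℝ) ω)]
    simp only [Set.indicator_apply, Pi.one_apply]
    rw [← Finset.sum_boole]
    refine Finset.sum_le_sum_of_subset_of_nonneg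
      (Finset.product_subset_product hsbox hsbox) fun p _ _ => ?_
    split_ifs <;> norm_num
  -- the combinatorial lemma
  have hcomb := FewClustersGlue.card_sq_le_mul_card_filter s r
    (fun x hx => ⟨Finset.mem_coe.2 (hbox (hsbox hx)), Finset.mem_coe.2 (hbox (hsbox hx)),
      SimpleGraph.Reachable.refl _⟩)
    (fun x _ y _ hxy => by
      obtain ⟨hx', hy', hr'⟩ := hxy
      exact ⟨hy', hx', hr'.symm⟩)
    (fun x _ y _ z _ hxy hyz => by
      obtain ⟨hx', _, hr'⟩ := hxy
      obtain ⟨_, hz', hr''⟩ := hyz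
      exact ⟨hx', hz', hr'.trans hr''⟩) N0
    (fun M hM hMind => hω M (hM.trans hsbox)
      (fun y hy => (Finset.mem_filter.1 (hM hy)).2) hMind)
  have hcomb' : ((s.card : ℝ)) ^ 2 ≤ N0 * (((s ×ˢ s).filter (fun p => r p.1 p.2)).card : ℝ) := by
    exact_mod_cast hcomb
  rw [hS]
  exact hcomb'.trans (mul_le_mul_of_nonneg_left hT (Nat.cast_nonneg N0))

/-! ## Measurability -/

/-- The translated arm event is measurable (pull-back of `{0 ↔ ∂Λ_n}` under a shift). [folklore] -/
theorem FewClustersGlue.measurableSet_armEvent {d : ℕ} (y : Site d) (n : ℕ) :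
    MeasurableSet (DCT16.armEvent y n) := by
  rw [← DCT16.preimage_shift_siteToBoundary]
  exact (BondConfig.relabel _).measurable (DCT16.measurableSet_siteToBoundary d n)

/-- The event `Few` ("every pairwise-unjoined family of armed sites has at most `N0` members") is
measurable: a countable intersection of finite Boolean combinations of arm and connection events.
[folklore] -/
theorem FewClustersGlue.measurableSet_few {d : ℕ} (N0 K n : ℕ) :
    MeasurableSet {ω : BondConfig (Site d) | ∀ F : Finset (Site d), F ⊆ box d n →
      (∀ y ∈ F, ω ∈ DCT16.armEvent y n) →
      (↑F : Set (Site d)).Pairwise (fun y z => ω ∉ openConnIn ↑(box d (K * n)) y z) →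
      F.card ≤ N0} := by
  have hC : ∀ y z : Site d,
      MeasurableSet (openConnIn (↑(box d (K * n)) : Set (Site d)) y z) :=
    fun y z => DCT16.measurableSet_openConnIn _ y z
  rw [Set.setOf_forall]
  refine MeasurableSet.iInter fun F => ?_
  by_cases hF : F ⊆ box d n
  · by_cases hcard : F.card ≤ N0
    · have : {ω : BondConfig (Site d) | F ⊆ box d n → (∀ y ∈ F, ω ∈ DCT16.armEvent y n) →
          (↑F : Set (Site d)).Pairwise (fun y z => ω ∉ openConnIn ↑(box d (K * n)) y z) →
          F.card ≤ N0} = Set.univ :=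
        Set.eq_univ_of_forall fun ω _ _ _ => hcard
      rw [this]
      exact MeasurableSet.univ
    · have : {ω : BondConfig (Site d) | F ⊆ box d n → (∀ y ∈ F, ω ∈ DCT16.armEvent y n) →
          (↑F : Set (Site d)).Pairwise (fun y z => ω ∉ openConnIn ↑(box d (K * n)) y z) →
          F.card ≤ N0} =
          ((⋂ y ∈ F, DCT16.armEvent y n) ∩
            ⋂ y ∈ F, ⋂ z ∈ F, {ω | y ≠ z →
              ω ∉ openConnIn (↑(box d (K * n)) : Set (Site d)) y z})ᶜ := by
        ext ω
        simp only [Set.mem_setOf_eq, Set.mem_compl_iff, Set.mem_inter_iff, Set.mem_iInter]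
        constructor
        · rintro h ⟨h1, h2⟩
          refine hcard (h hF h1 ?_)
          intro y hy z hz hyz
          exact h2 y hy z hz hyz
        · intro h _ h1 h2
          exact (h ⟨h1, fun y hy z hz hyz => @h2 y hy z hz hyz⟩).elim
      rw [this]
      refine MeasurableSet.compl (MeasurableSet.inter ?_ ?_)
      · exact Finset.measurableSet_biInter F fun y _ => FewClustersGlue.measurableSet_armEvent y n
      · refine Finset.measurableSet_biInter F fun y _ => Finset.measurableSet_biInter F fun z _ => ?_
        by_cases hyz : y = z
        · have : {ω : BondConfig (Site d) | y ≠ z →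
              ω ∉ openConnIn (↑(box d (K * n)) : Set (Site d)) y z} = Set.univ :=
            Set.eq_univ_of_forall fun ω h => absurd hyz h
          rw [this]
          exact MeasurableSet.univ
        · have : {ω : BondConfig (Site d) | y ≠ z →
              ω ∉ openConnIn (↑(box d (K * n)) : Set (Site d)) y z} =
              (openConnIn (↑(box d (K * n)) : Set (Site d)) y z)ᶜ := by
            ext ω
            simp [hyz]
          rw [this]
          exact (hC y z).compl
  · have : {ω : BondConfig (Site d) | F ⊆ box d n → (∀ y ∈ F, ω ∈ DCT16.armEvent y n) →
        (↑F : Set (Site d)).Pairwise (fun y z => ω ∉ openConnIn ↑(box d (K * n)) y z) →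
        F.card ≤ N0} = Set.univ :=
      Set.eq_univ_of_forall fun ω h => absurd h hF
    rw [this]
    exact MeasurableSet.univ

end Summit.CriticalPhenomena.PercolationContinuityZ3.Theorems

end
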